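import Literature.NumberTheory.Sieve.GoldstonYildirimLemma21
import Literature.NumberTheory.Sieve.CoprimeMoebiusLogSums
import Literature.NumberTheory.Sieve.GreenTao2008MoebiusLogSum
import Literature.NumberTheory.Sieve.CoprimeMoebiusHarmonicDecay
import HarnessLib

/-!
# Goldston–Yıldırım I, Lemma 2.1: proofs of (2.11)–(2.12) at `j = 0` and of (2.13) at `j = 1`

Topic `Literature/NumberTheory/Sieve`. Everything in this file is PROVED. It discharges the named
fact `Literature.NumberTheory.Sieve.goldstonYildirim_lemma21_log_j0` of
`GoldstonYildirimLemma21.lean` (D. A. Goldston, C. Y. Yıldırım, *Higher correlations of divisor sums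
related to primes I: triple correlations*, Integers 3 (2003) A5 = arXiv:math/0111212, Lemma 2.1,
p. 13, eq. (2.11)–(2.12) with `j = 0`):

  `Σ_{d ≤ R, (d,k)=1} μ(d)/d · log(R/d) = k/φ(k) + O_B(exp(-c√log R))`  (`k ≤ R^B`, `c` absolute),

as `goldstonYildirim_lemma21_log_j0_holds`, by an elementary route through results already in the
tree (the source argues by contour integration and the zero-free region, pp. 15–18); see the
section docstring below for the architecture. It then discharges the fact recording
eq. (2.13) of the same lemma at `j = 1` (`φ₁ = φ`),

  `Σ_{d ≤ R, (d,k)=1} μ(d)/φ(d) ≪_B exp(-c√log R)`  (`k ≤ R^B`, `c` absolute),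

as `goldstonYildirim_lemma21_j1_holds` (second part of the file, with its own section docstring),
from the uniform bound for `Σ_{n ≤ N,(n,k)=1} μ(n)/n` of `CoprimeMoebiusHarmonicDecay.lean`; (2.13)
at `j = 0` is discharged in the sibling `GoldstonYildirimLemma21MoebiusSumProofs.lean`
(`goldstonYildirim_lemma21_j0_holds`). Still a named fact: (2.11)–(2.12) at `j = 1`
(`goldstonYildirim_lemma21_log_j1`, main term the pair singular series).

## References

* D. A. Goldston, C. Y. Yıldırım, *Higher correlations of divisor sums related to primes I:
  triple correlations*, Integers 3 (2003), A5; arXiv:math/0111212, Lemma 2.1 and §3.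
  [cite: GoldstonYildirim2001, Lemma 2.1, pp. 13, 15–18]
* S. W. Graham, *An asymptotic estimate related to Selberg's sieve*, J. Number Theory 10 (1978),
  83–94 (the case `j = 0` by elementary means). [folklore]

## Mathlib / tree search

Mathlib: `EulerProduct.summable_and_hasSum_factoredNumbers_prod_filter_prime_geometric`,
`Nat.factoredNumbers`, `hasSum_subtype_iff_indicator`, `hasSum_le`, `Finset.induction_on_max`,
`ArithmeticFunction.coe_zeta_mul_coe_moebius`. Tree: `CoprimeMoebius.muCop/fCop`,
`CoprimeMoebius.sum_fCop_div_le`, `SquarefreeSums.sum_Icc_sum_divisorsAntidiagonal`,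
`GreenTao2008.exists_abs_moebiusLogSum_sub_one_le`, `GreenTao2008.exists_abs_moebiusLogSum_le`,
`LFunctions.MertensBound.totient_eq_mul_prod_one_sub_inv`
(`lean search 'goldstonYildirim_lemma21|muCop|factoredNumbers'`); for (2.13) also
`PlateauMollifier.coprimeMoebiusInvAF`, `ArithmeticFunction.sum_Ioc_mul_eq_sum_sum`,
`ArithmeticFunction.IsMultiplicative.eq_iff_eq_on_prime_powers` and `CoprimeMoebiusDecay.*`.
-/

noncomputable section

namespace Literature.NumberTheory.Sieve

/-! ## Proof of (2.11)–(2.12) at `j = 0` (`goldstonYildirim_lemma21_log_j0_holds`)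

Everything below is PROVED. Goldston–Yıldırım prove Lemma 2.1 by contour integration
(pp. 15–18 of arXiv:math/0111212: `F(s) = Σ_{(n,k)=1} μ(n)/(φ_j(n) n^s) = ζ(s+1)⁻¹ g_k(s) h_k(s)`,
Perron's formula, the classical zero-free region). Here we take the shorter elementary road the
tree already paves: with `f_k = 𝟙{m : p ∣ m ⇒ p ∣ k}` (`CoprimeMoebius.fCop k`, the indicator of the
`k`-factored numbers) one has `μ·𝟙_{(·,k)=1} = f_k ⋆ μ` (`CoprimeMoebius.muCop k = fCop k * μ`), hence,
writing `M₁(x) = Σ_{e ≤ x} μ(e) log(x/e)/e` (`GreenTao2008.moebiusLogSum`),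

  `Σ_{d ≤ R, (d,k)=1} μ(d)/d · log(R/d) = Σ_{m ≤ R} f_k(m)/m · M₁(R/m)`        (hyperbola swap),

and the tree's `M₁(x) = 1 + O(exp(-c₁√log x))` (`GreenTao2008.exists_abs_moebiusLogSum_sub_one_le`,
a statement of prime-number-theorem depth proved there from `Σ μ(n)/n ≪ exp(-c√log x)`) reduces
everything to sums over `k`-factored numbers: `Σ_{m k-factored} 1/m = ∏_{p ∣ k}(1 - 1/p)⁻¹ = k/φ(k)`
(Mathlib's Euler product over `Nat.factoredNumbers`), the tails `Σ_{m > y, k-factored} 1/m ≤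
y^{-1/2} ∏_{p ∣ k}(1 - p^{-1/2})⁻¹ ≤ y^{-1/2} exp(8 √(ω(k)+1))` (Rankin's trick; compare GY's bound
(3.5), `|g_k(s)| ≪ exp(4√log k)`), and `k/φ(k) ≤ ω(k) + 1 ≤ 2 log k + 1 ≤ 2B log R + 1`. The
power savings `R^{-1/2}`, `R^{-1/4}` of the tails absorb `exp(O(√(B log R)))`, and the polylogarithmic
size of `k/φ(k)` is absorbed by `exp(-(c₁/4)√log R)`; this is where the hypothesis `log k ≪ log R`
enters, exactly as on p. 17 of the source, and why the final exponent `c = min(c₁/4, 1/8)` is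
independent of `B` while the constant `C` is not. -/

namespace GoldstonYildirimLemma21

open Finset Real ArithmeticFunction CoprimeMoebius GreenTao2008

open scoped ArithmeticFunction.Moebius ArithmeticFunction.zeta

/-! ### Finite sets of primes: `∏ (1 - 1/p)⁻¹ ≤ |P| + 1` and `Σ p^{-1/2} ≤ 2√(|P|+1)` -/

/-- A finite set of primes all of which are `< a`, `a` prime, has at most `a - 2` elements.
[folklore] -/
theorem card_add_two_le_of_lt {s : Finset ℕ} {a : ℕ} (hs : ∀ p ∈ s, p.Prime) (ha : a.Prime)
    (hlt : ∀ x ∈ s, x < a) : s.card + 2 ≤ a := by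
  have hsub : s ⊆ Finset.Ico 2 a := fun p hp => Finset.mem_Ico.2 ⟨(hs p hp).two_le, hlt p hp⟩
  have h := Finset.card_le_card hsub
  rw [Nat.card_Ico] at h
  have := ha.two_le
  omega

/-- `∏_{p ∈ P} (1 - 1/p)⁻¹ ≤ |P| + 1` for a finite set of primes `P` (the `i`-th smallest prime of
`P` is at least `i + 1`, and `∏_{i ≤ r} (1 + 1/i) = r + 1`). [folklore] -/
theorem prod_inv_one_sub_inv_le_card (P : Finset ℕ) (hP : ∀ p ∈ P, p.Prime) :
    ∏ p ∈ P, (1 - (p : ℝ)⁻¹)⁻¹ ≤ P.card + 1 := by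
  induction P using Finset.induction_on_max with
  | empty => simp
  | insert a s hlt ih =>
    have ha : a.Prime := hP a (mem_insert_self a s)
    have hs : ∀ p ∈ s, p.Prime := fun p hp => hP p (mem_insert_of_mem hp)
    have has : a ∉ s := fun h => lt_irrefl a (hlt a h)
    rw [prod_insert has, card_insert_of_notMem has]
    have hn : (s.card : ℝ) + 2 ≤ a := by exact_mod_cast card_add_two_le_of_lt hs ha hlt
    have ha1 : (1 : ℝ) < a := by exact_mod_cast ha.one_lt
    have hfac : (1 - (a : ℝ)⁻¹)⁻¹ ≤ ((s.card : ℝ) + 2) / ((s.card : ℝ) + 1) := by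
      have ha0 : (0 : ℝ) < a := by linarith
      rw [show (1 - (a : ℝ)⁻¹)⁻¹ = a / (a - 1) by field_simp]
      rw [div_le_div_iff₀ (by linarith) (by positivity)]
      nlinarith
    have h0 : 0 ≤ ∏ p ∈ s, (1 - (p : ℝ)⁻¹)⁻¹ := prod_nonneg fun p hp => by
      have hp2 : (2 : ℝ) ≤ p := by exact_mod_cast (hs p hp).two_le
      have : (p : ℝ)⁻¹ ≤ 2⁻¹ := inv_anti₀ (by norm_num) hp2
      exact inv_nonneg.2 (by linarith [this])
    calc (1 - (a : ℝ)⁻¹)⁻¹ * ∏ p ∈ s, (1 - (p : ℝ)⁻¹)⁻¹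
        ≤ ((s.card : ℝ) + 2) / ((s.card : ℝ) + 1) * ((s.card : ℝ) + 1) :=
          mul_le_mul hfac (ih hs) h0 (by positivity)
      _ = (s.card : ℝ) + 2 := by field_simp
      _ = ((s.card + 1 : ℕ) : ℝ) + 1 := by push_cast; ring

/-- `Σ_{p ∈ P} p^{-1/2} ≤ 2 √(|P| + 1)` for a finite set of primes `P`. [folklore] -/
theorem sum_rpow_neg_half_le_sqrt_card (P : Finset ℕ) (hP : ∀ p ∈ P, p.Prime) :
    ∑ p ∈ P, (p : ℝ) ^ (-(1 / 2 : ℝ)) ≤ 2 * Real.sqrt (P.card + 1) := by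
  induction P using Finset.induction_on_max with
  | empty => simp
  | insert a s hlt ih =>
    have ha : a.Prime := hP a (mem_insert_self a s)
    have hs : ∀ p ∈ s, p.Prime := fun p hp => hP p (mem_insert_of_mem hp)
    have has : a ∉ s := fun h => lt_irrefl a (hlt a h)
    rw [sum_insert has, card_insert_of_notMem has]
    have hn : (s.card : ℝ) + 2 ≤ a := by exact_mod_cast card_add_two_le_of_lt hs ha hlt
    set A : ℝ := Real.sqrt ((s.card : ℝ) + 2) with hA
    set B : ℝ := Real.sqrt ((s.card : ℝ) + 1) with hB
    have hA0 : 0 < A := Real.sqrt_pos.2 (by positivity)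
    have hB0 : 0 ≤ B := Real.sqrt_nonneg _
    have hA2 : A ^ 2 = (s.card : ℝ) + 2 := Real.sq_sqrt (by positivity)
    have hB2 : B ^ 2 = (s.card : ℝ) + 1 := Real.sq_sqrt (by positivity)
    -- `a^{-1/2} ≤ (n+2)^{-1/2} = 1/A ≤ 2 (A - B)`
    have h1 : (a : ℝ) ^ (-(1 / 2 : ℝ)) ≤ A⁻¹ := by
      rw [Real.rpow_neg (by positivity), ← Real.sqrt_eq_rpow]
      exact inv_anti₀ hA0 (Real.sqrt_le_sqrt hn)
    have h2 : A⁻¹ ≤ 2 * (A - B) := by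
      rw [inv_le_iff_one_le_mul₀ hA0]
      nlinarith [sq_nonneg (A - B)]
    have hcast : ((s.card + 1 : ℕ) : ℝ) + 1 = (s.card : ℝ) + 2 := by push_cast; ring
    rw [hcast]
    linarith [ih hs]

/-- `∏_{p ∈ P} (1 - p^{-1/2})⁻¹ ≤ exp(8 √(|P| + 1))` for a finite set of primes `P`
(`(1 - x)⁻¹ ≤ 1 + 4x ≤ e^{4x}` for `0 ≤ x ≤ 2^{-1/2}`). [folklore] -/
theorem prod_inv_one_sub_rpow_le_exp (P : Finset ℕ) (hP : ∀ p ∈ P, p.Prime) :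
    ∏ p ∈ P, (1 - (p : ℝ) ^ (-(1 / 2 : ℝ)))⁻¹ ≤ Real.exp (8 * Real.sqrt (P.card + 1)) := by
  have hx : ∀ p ∈ P, 0 ≤ (p : ℝ) ^ (-(1 / 2 : ℝ)) ∧ (p : ℝ) ^ (-(1 / 2 : ℝ)) ≤ 3 / 4 := by
    intro p hp
    have hp2 : (2 : ℝ) ≤ p := by exact_mod_cast (hP p hp).two_le
    refine ⟨by positivity, ?_⟩
    calc (p : ℝ) ^ (-(1 / 2 : ℝ)) ≤ (2 : ℝ) ^ (-(1 / 2 : ℝ)) :=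
          Real.rpow_le_rpow_of_nonpos (by norm_num) hp2 (by norm_num)
      _ ≤ 3 / 4 := by
          rw [Real.rpow_neg (by norm_num), ← Real.sqrt_eq_rpow]
          rw [inv_le_comm₀ (by positivity) (by norm_num)]
          exact Real.le_sqrt_of_sq_le (by norm_num)
  have hfac : ∀ p ∈ P, (1 - (p : ℝ) ^ (-(1 / 2 : ℝ)))⁻¹ ≤ 1 + 4 * (p : ℝ) ^ (-(1 / 2 : ℝ)) := by
    intro p hp
    obtain ⟨h0, h1⟩ := hx p hp
    rw [inv_le_iff_one_le_mul₀' (by linarith)]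
    nlinarith
  calc ∏ p ∈ P, (1 - (p : ℝ) ^ (-(1 / 2 : ℝ)))⁻¹
      ≤ ∏ p ∈ P, (1 + 4 * (p : ℝ) ^ (-(1 / 2 : ℝ))) :=
        prod_le_prod (fun p hp => inv_nonneg.2 (by linarith [(hx p hp).2])) hfac
    _ ≤ Real.exp (∑ p ∈ P, 4 * (p : ℝ) ^ (-(1 / 2 : ℝ))) :=
        SquarefreeSums.prod_one_add_le_exp_sum fun p hp => by linarith [(hx p hp).1]
    _ ≤ Real.exp (8 * Real.sqrt (P.card + 1)) := by
        rw [← mul_sum]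
        exact Real.exp_le_exp.2 (by linarith [sum_rpow_neg_half_le_sqrt_card P hP])

/-- `ω(k) ≤ 2B log R` when `1 ≤ k ≤ R^B` (`2^{ω(k)} ≤ ∏_{p ∣ k} p ≤ k` and `log 2 > 1/2`): the
form in which the hypothesis `log k ≪ log R` of Lemma 2.1 enters. [folklore] -/
theorem card_primeFactors_le_of_le_rpow {k : ℕ} (hk : k ≠ 0) {R B : ℝ} (hR : 0 < R)
    (hkR : (k : ℝ) ≤ R ^ B) : (k.primeFactors.card : ℝ) ≤ 2 * B * Real.log R := by
  have h2 : 2 ^ k.primeFactors.card ≤ k := by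
    calc 2 ^ k.primeFactors.card ≤ ∏ p ∈ k.primeFactors, p :=
          Finset.pow_card_le_prod _ _ 2 fun p hp => (Nat.prime_of_mem_primeFactors hp).two_le
      _ ≤ k := Nat.le_of_dvd (Nat.pos_of_ne_zero hk) (Nat.prod_primeFactors_dvd k)
  have h3 : (2 : ℝ) ^ k.primeFactors.card ≤ k := by exact_mod_cast h2
  have h4 : (k.primeFactors.card : ℝ) * Real.log 2 ≤ Real.log k := by
    rw [← Real.log_pow]
    exact Real.log_le_log (by positivity) h3
  have h5 : Real.log k ≤ B * Real.log R := by
    calc Real.log k ≤ Real.log (R ^ B) :=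
          Real.log_le_log (by exact_mod_cast Nat.pos_of_ne_zero hk) hkR
      _ = B * Real.log R := Real.log_rpow hR B
  have hlog2 : (1 / 2 : ℝ) < Real.log 2 := by linarith [Real.log_two_gt_d9]
  have h0 : (0 : ℝ) ≤ k.primeFactors.card := Nat.cast_nonneg _
  nlinarith

/-! ### The `k`-factored numbers: `f_k`, Euler products, Rankin tails -/

/-- `μ_k = f_k ⋆ μ` (`f_k = μ_k ⋆ ζ` and `ζ ⋆ μ = 1`). [folklore] -/
theorem muCop_eq_fCop_mul_moebius (k : ℕ) :
    muCop k = fCop k * ((μ : ArithmeticFunction ℤ) : ArithmeticFunction ℝ) := by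
  unfold fCop
  rw [mul_assoc, coe_zeta_mul_coe_moebius, mul_one]

/-- For `k ≥ 1`, the indicator of the `k`-factored numbers (Mathlib's
`Nat.factoredNumbers k.primeFactors`) is `f_k`. [folklore] -/
theorem indicator_factoredNumbers_eq_fCop_mul {k : ℕ} (hk : k ≠ 0) (g : ℕ → ℝ) (hg : g 0 = 0)
    (m : ℕ) : (Nat.factoredNumbers k.primeFactors).indicator g m = fCop k m * g m := by
  rcases eq_or_ne m 0 with rfl | hm
  · simp [hg]
  rw [fCop_eq_indicator hm, Set.indicator_apply]
  have hiff : m ∈ Nat.factoredNumbers k.primeFactors ↔ ∀ p ∈ m.primeFactors, p ∣ k := by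
    rw [Nat.mem_factoredNumbers_iff_primeFactors_subset]
    constructor
    · rintro ⟨-, h⟩ p hp
      exact Nat.dvd_of_mem_primeFactors (h hp)
    · intro h
      exact ⟨hm, fun p hp => Nat.mem_primeFactors.2 ⟨Nat.prime_of_mem_primeFactors hp, h p hp, hk⟩⟩
  by_cases h : ∀ p ∈ m.primeFactors, p ∣ k
  · rw [if_pos (hiff.2 h), if_pos h, one_mul]
  · rw [if_neg (fun h' => h (hiff.1 h')), if_neg h, zero_mul]

/-- **Euler product over the `k`-factored numbers**: for `t > 0`,
`Σ_m f_k(m) m^{-t} = ∏_{p ∣ k} (1 - p^{-t})⁻¹` (Mathlib's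
`EulerProduct.summable_and_hasSum_factoredNumbers_prod_filter_prime_geometric`). [folklore] -/
theorem hasSum_fCop_mul_rpow {k : ℕ} (hk : k ≠ 0) {t : ℝ} (ht : 0 < t) :
    HasSum (fun m : ℕ => fCop k m * (m : ℝ) ^ (-t))
      (∏ p ∈ k.primeFactors, (1 - (p : ℝ) ^ (-t))⁻¹) := by
  -- `n ↦ n^{-t}` as a monoid hom
  let f : ℕ →* ℝ :=
    { toFun := fun n => (n : ℝ) ^ (-t)
      map_one' := by simp
      map_mul' := fun m n => by
        push_cast
        exact Real.mul_rpow (Nat.cast_nonneg m) (Nat.cast_nonneg n) }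
  have hf : ∀ n : ℕ, f n = (n : ℝ) ^ (-t) := fun n => rfl
  have hP : ∀ p ∈ k.primeFactors, p.Prime := fun p hp => Nat.prime_of_mem_primeFactors hp
  have hlt : ∀ {p : ℕ}, p.Prime → ‖f p‖ < 1 := by
    intro p hp
    rw [hf, Real.norm_eq_abs, abs_of_nonneg (by positivity)]
    have hp2 : (2 : ℝ) ≤ p := by exact_mod_cast hp.two_le
    exact Real.rpow_lt_one_of_one_lt_of_neg (by linarith) (by linarith)
  have h := (EulerProduct.summable_and_hasSum_factoredNumbers_prod_filter_prime_geometric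
    hlt k.primeFactors).2
  rw [Finset.filter_true_of_mem hP] at h
  simp only [hf] at h
  have h2 : HasSum ((Nat.factoredNumbers k.primeFactors).indicator (fun m : ℕ => (m : ℝ) ^ (-t)))
      (∏ p ∈ k.primeFactors, (1 - (p : ℝ) ^ (-t))⁻¹) := by
    rw [← hasSum_subtype_iff_indicator]
    exact h
  have heq : (Nat.factoredNumbers k.primeFactors).indicator (fun m : ℕ => (m : ℝ) ^ (-t)) =
      fun m => fCop k m * (m : ℝ) ^ (-t) := by
    funext m
    refine indicator_factoredNumbers_eq_fCop_mul hk _ ?_ m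
    simp [Real.zero_rpow (neg_ne_zero.2 ht.ne')]
  rwa [heq] at h2

/-- `k/φ(k) = ∏_{p ∣ k} (1 - 1/p)⁻¹`. [folklore] -/
theorem cast_div_totient_eq_prod {k : ℕ} (hk : k ≠ 0) :
    (k : ℝ) / (k.totient : ℝ) = ∏ p ∈ k.primeFactors, (1 - (p : ℝ)⁻¹)⁻¹ := by
  rw [Literature.NumberTheory.LFunctions.MertensBound.totient_eq_mul_prod_one_sub_inv k,
    prod_inv_distrib]
  have hk0 : (k : ℝ) ≠ 0 := by exact_mod_cast hk
  rw [← div_div, div_self hk0, one_div]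
  simp only [one_div]

/-- `Σ_m f_k(m)/m = k/φ(k)`. [folklore] -/
theorem hasSum_fCop_div {k : ℕ} (hk : k ≠ 0) :
    HasSum (fun m : ℕ => fCop k m / m) ((k : ℝ) / k.totient) := by
  have h := hasSum_fCop_mul_rpow hk one_pos
  have heq : (fun m : ℕ => fCop k m * (m : ℝ) ^ (-(1 : ℝ))) = fun m : ℕ => fCop k m / m := by
    funext m
    rw [Real.rpow_neg_one, div_eq_mul_inv]
  rw [heq, prod_congr rfl (fun p _ => by rw [Real.rpow_neg_one])] at h
  rwa [cast_div_totient_eq_prod hk]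

/-- `1/m = m^{-1/2} · m^{-1/2}`. [folklore] -/
theorem inv_eq_rpow_mul_rpow {x : ℝ} (hx : 0 < x) :
    x⁻¹ = x ^ (-(1 / 2 : ℝ)) * x ^ (-(1 / 2 : ℝ)) := by
  rw [← Real.rpow_add hx, show (-(1 / 2 : ℝ)) + -(1 / 2 : ℝ) = -1 by norm_num, Real.rpow_neg_one]

/-- **Rankin tail for the main term**: for `k ≥ 1`, `R ≥ 1`,
`k/φ(k) - Σ_{m ≤ R} f_k(m)/m ≤ R^{-1/2} ∏_{p ∣ k} (1 - p^{-1/2})⁻¹`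
(`1/m ≤ R^{-1/2} m^{-1/2}` for `m > R`). [folklore] -/
theorem div_totient_sub_sum_le {k : ℕ} (hk : k ≠ 0) {R : ℝ} (hR : 1 ≤ R) :
    (k : ℝ) / k.totient - ∑ m ∈ Icc 1 ⌊R⌋₊, fCop k m / m ≤
      R ^ (-(1 / 2 : ℝ)) * ∏ p ∈ k.primeFactors, (1 - (p : ℝ) ^ (-(1 / 2 : ℝ)))⁻¹ := by
  have hR0 : 0 < R := by linarith
  set N := ⌊R⌋₊ with hN
  set Z := ∏ p ∈ k.primeFactors, (1 - (p : ℝ) ^ (-(1 / 2 : ℝ)))⁻¹ with hZ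
  have hfin : HasSum (fun m : ℕ => if m ∈ Icc 1 N then fCop k m / m else 0)
      (∑ m ∈ Icc 1 N, fCop k m / m) := by
    have h : HasSum (fun m : ℕ => if m ∈ Icc 1 N then fCop k m / m else 0)
        (∑ m ∈ Icc 1 N, if m ∈ Icc 1 N then fCop k m / m else 0) :=
      hasSum_sum_of_ne_finset_zero fun m hm => if_neg hm
    rwa [sum_congr rfl (fun m hm => if_pos hm)] at h
  have htail : HasSum (fun m : ℕ => R ^ (-(1 / 2 : ℝ)) * (fCop k m * (m : ℝ) ^ (-(1 / 2 : ℝ))))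
      (R ^ (-(1 / 2 : ℝ)) * Z) := (hasSum_fCop_mul_rpow hk (by norm_num)).mul_left _
  have hle : ∀ m : ℕ, fCop k m / m ≤ (if m ∈ Icc 1 N then fCop k m / m else 0) +
      R ^ (-(1 / 2 : ℝ)) * (fCop k m * (m : ℝ) ^ (-(1 / 2 : ℝ))) := by
    intro m
    have hf0 := (fCop_nonneg_le_one k m).1
    have hY0 : 0 ≤ R ^ (-(1 / 2 : ℝ)) * (fCop k m * (m : ℝ) ^ (-(1 / 2 : ℝ))) := by positivity
    by_cases hm : m ∈ Icc 1 N
    · rw [if_pos hm]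
      linarith
    · rw [if_neg hm, zero_add]
      rcases Nat.eq_zero_or_pos m with rfl | hm0
      · simp
      · have hNm : N < m := by
          rw [mem_Icc] at hm
          omega
        have hmR : R ≤ m := by
          have h1 : R < (N : ℝ) + 1 := Nat.lt_floor_add_one R
          have h2 : (N : ℝ) + 1 ≤ m := by exact_mod_cast hNm
          linarith
        have hm0' : (0 : ℝ) < m := by exact_mod_cast hm0
        have hmono : (m : ℝ) ^ (-(1 / 2 : ℝ)) ≤ R ^ (-(1 / 2 : ℝ)) :=
          Real.rpow_le_rpow_of_nonpos hR0 hmR (by norm_num)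
        rw [div_eq_mul_inv, inv_eq_rpow_mul_rpow hm0']
        calc fCop k m * ((m : ℝ) ^ (-(1 / 2 : ℝ)) * (m : ℝ) ^ (-(1 / 2 : ℝ)))
            ≤ fCop k m * (R ^ (-(1 / 2 : ℝ)) * (m : ℝ) ^ (-(1 / 2 : ℝ))) :=
              mul_le_mul_of_nonneg_left (mul_le_mul_of_nonneg_right hmono (by positivity)) hf0
          _ = R ^ (-(1 / 2 : ℝ)) * (fCop k m * (m : ℝ) ^ (-(1 / 2 : ℝ))) := by ring
  have h := hasSum_le hle (hasSum_fCop_div hk) (hfin.add htail)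
  linarith

/-! ### The hyperbola swap -/

/-- **`Σ_{d ≤ R, (d,k)=1} μ(d)/d · log(R/d) = Σ_{m ≤ R} f_k(m)/m · M₁(R/m)`** with
`M₁(x) = Σ_{e ≤ x} μ(e) log(x/e)/e` (`μ_k = f_k ⋆ μ` and Dirichlet's rearrangement). [folklore] -/
theorem sum_coprime_moebius_log_eq_sum_fCop (k : ℕ) (R : ℝ) :
    ∑ d ∈ (Icc 1 ⌊R⌋₊).filter (fun d => Nat.Coprime d k),
        ((μ d : ℤ) : ℝ) / (d : ℝ) * Real.log (R / d) =
      ∑ m ∈ Icc 1 ⌊R⌋₊, fCop k m / m * moebiusLogSum (R / m) := by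
  set N := ⌊R⌋₊ with hN
  -- rewrite with `μ_k`
  have hA : ∑ d ∈ (Icc 1 N).filter (fun d => Nat.Coprime d k), ((μ d : ℤ) : ℝ) / (d : ℝ) * Real.log (R / d) =
      ∑ d ∈ Icc 1 N, muCop k d / d * Real.log (R / d) := by
    rw [sum_filter]
    refine sum_congr rfl fun d hd => ?_
    have hd1 : d ≠ 0 := by have := (mem_Icc.1 hd).1; omega
    rw [muCop_apply hd1]
    split_ifs <;> simp
  rw [hA]
  -- open `μ_k(d) = Σ_{me = d} f_k(m) μ(e)`
  have hB : ∀ d ∈ Icc 1 N, muCop k d / d * Real.log (R / d) =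
      ∑ q ∈ d.divisorsAntidiagonal,
        fCop k q.1 / q.1 * (((μ q.2 : ℤ) : ℝ) / q.2 * Real.log (R / q.1 / q.2)) := by
    intro d _
    rw [muCop_eq_fCop_mul_moebius, mul_apply, sum_div, sum_mul]
    refine sum_congr rfl fun q hq => ?_
    obtain ⟨hqd, hd0⟩ := Nat.mem_divisorsAntidiagonal.1 hq
    have hq1 : q.1 ≠ 0 := fun h0 => hd0 (by rw [← hqd, h0, zero_mul])
    have hq2 : q.2 ≠ 0 := fun h0 => hd0 (by rw [← hqd, h0, mul_zero])
    have hq1' : (q.1 : ℝ) ≠ 0 := by exact_mod_cast hq1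
    have hq2' : (q.2 : ℝ) ≠ 0 := by exact_mod_cast hq2
    have hcast : (d : ℝ) = q.1 * q.2 := by rw [← hqd]; push_cast; ring
    rw [hcast, intCoe_apply, div_div R]
    field_simp
  rw [sum_congr rfl hB, SquarefreeSums.sum_Icc_sum_divisorsAntidiagonal
    (fun m e => fCop k m / m * (((μ e : ℤ) : ℝ) / e * Real.log (R / m / e))) N]
  refine sum_congr rfl fun m _ => ?_
  rw [moebiusLogSum_def, mul_sum, hN, ← Nat.floor_div_natCast R m]

/-! ### `M₁(x) = 1 + O(exp(-c√log x))` for all `x ≥ 1` -/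

/-- The tree's `|M₁(u) - 1| ≤ C exp(-c√log u)` (`u ≥ 2`) extended to `u ≥ 1` (on `[1,2)` both sides
are bounded). [folklore] -/
theorem exists_abs_moebiusLogSum_sub_one_le_of_one_le :
    ∃ c : ℝ, 0 < c ∧ ∃ C : ℝ, 0 ≤ C ∧ ∀ u : ℝ, 1 ≤ u →
      |moebiusLogSum u - 1| ≤ C * Real.exp (-(c * Real.sqrt (Real.log u))) := by
  obtain ⟨c, hc, C, hC, h⟩ := exists_abs_moebiusLogSum_sub_one_le
  obtain ⟨C₀, hC₀, h₀⟩ := exists_abs_moebiusLogSum_le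
  refine ⟨c, hc, max C ((C₀ + 1) * Real.exp c), le_max_of_le_left hC, fun u hu => ?_⟩
  rcases le_or_gt 2 u with h2 | h2
  · exact (h u h2).trans (mul_le_mul_of_nonneg_right (le_max_left _ _) (Real.exp_pos _).le)
  · have hlog : Real.log u ≤ 1 := by
      have h1 : Real.log u ≤ Real.log 2 := Real.log_le_log (by linarith) h2.le
      linarith [Real.log_two_lt_d9]
    have hsq : Real.sqrt (Real.log u) ≤ 1 := Real.sqrt_le_one.2 hlog
    have hexp : Real.exp (-c) ≤ Real.exp (-(c * Real.sqrt (Real.log u))) :=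
      Real.exp_le_exp.2 (by nlinarith)
    calc |moebiusLogSum u - 1| ≤ |moebiusLogSum u| + |(1 : ℝ)| := abs_sub _ _
      _ ≤ C₀ + 1 := by rw [abs_one]; exact add_le_add (h₀ u) le_rfl
      _ = (C₀ + 1) * Real.exp c * Real.exp (-c) := by
          rw [mul_assoc, ← Real.exp_add, add_neg_cancel, Real.exp_zero, mul_one]
      _ ≤ (C₀ + 1) * Real.exp c * Real.exp (-(c * Real.sqrt (Real.log u))) :=
          mul_le_mul_of_nonneg_left hexp (by positivity)
      _ ≤ max C ((C₀ + 1) * Real.exp c) * Real.exp (-(c * Real.sqrt (Real.log u))) :=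
          mul_le_mul_of_nonneg_right (le_max_right _ _) (Real.exp_pos _).le

/-! ### Two real-variable inequalities -/

/-- `u² e^{-au} ≤ 2/a²` for `a > 0`, `u ≥ 0` (`(au)²/2 ≤ e^{au}`). [folklore] -/
theorem sq_mul_exp_neg_mul_le {a u : ℝ} (ha : 0 < a) (hu : 0 ≤ u) :
    u ^ 2 * Real.exp (-(a * u)) ≤ 2 / a ^ 2 := by
  have h := Real.pow_div_factorial_le_exp (a * u) (by positivity) 2
  rw [Nat.factorial_two] at h
  push_cast at h
  rw [Real.exp_neg, ← div_eq_mul_inv, div_le_div_iff₀ (Real.exp_pos _) (by positivity)]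
  nlinarith [h]

/-- The bookkeeping of the constants: with `u = √log R`, `ρ = ω(k) ≤ 2B u²`,
`A = Σ_{m ≤ R} f_k(m)/m ≤ Φ = k/φ(k) ≤ ρ + 1`, `Z = ∏_{p∣k}(1 - p^{-1/2})⁻¹ ≤ exp(8√(ρ+1))`, the
three error terms are `≤ C(B) e^{-cu}` for `c ≤ min(c₁/4, 1/8)`. [folklore] -/
theorem error_terms_le {c₁ u B C₁ C₀ A Φ Z ρ c : ℝ} (hc₁ : 0 < c₁) (hu : 0 ≤ u) (hB : 0 ≤ B)
    (hC₁ : 0 ≤ C₁) (hC₀ : 0 ≤ C₀) (hAΦ : A ≤ Φ) (hΦ : Φ ≤ ρ + 1)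
    (hρ : ρ ≤ 2 * B * u ^ 2) (hZ0 : 0 ≤ Z)
    (hZ : Z ≤ Real.exp (8 * Real.sqrt (ρ + 1))) (hca : c ≤ c₁ / 4) (hc8 : c ≤ 1 / 8) :
    C₁ * Real.exp (-(c₁ / 2) * u) * A + (C₀ + 1) * Real.exp (-(u ^ 2 / 4)) * Z +
        Real.exp (-(u ^ 2 / 2)) * Z ≤
      (C₁ * (64 * B / c₁ ^ 2 + 1) +
          (C₀ + 2) * Real.exp (8 + (8 * Real.sqrt (2 * B) + 1 / 8) ^ 2)) * Real.exp (-c * u) := by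
  set b : ℝ := 8 * Real.sqrt (2 * B) + 1 / 8 with hb
  set a : ℝ := c₁ / 4 with ha
  have ha0 : 0 < a := by positivity
  have hsB : 0 ≤ Real.sqrt (2 * B) := Real.sqrt_nonneg _
  have hsB2 : Real.sqrt (2 * B) ^ 2 = 2 * B := Real.sq_sqrt (by positivity)
  -- `√(ρ+1) ≤ √(2B) u + 1`
  have hsq : Real.sqrt (ρ + 1) ≤ Real.sqrt (2 * B) * u + 1 := by
    calc Real.sqrt (ρ + 1) ≤ Real.sqrt ((Real.sqrt (2 * B) * u + 1) ^ 2) :=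
          Real.sqrt_le_sqrt (by nlinarith [mul_nonneg hsB hu])
      _ = Real.sqrt (2 * B) * u + 1 := Real.sqrt_sq (by positivity)
  -- the common exponential factor of the two tails
  have hcu : Real.exp (-(u / 8)) ≤ Real.exp (-c * u) := Real.exp_le_exp.2 (by nlinarith)
  have hau : Real.exp (-(a * u)) ≤ Real.exp (-c * u) := Real.exp_le_exp.2 (by nlinarith)
  have hK : Real.exp (-(u ^ 2 / 4)) * Z ≤ Real.exp (8 + b ^ 2) * Real.exp (-c * u) := by
    calc Real.exp (-(u ^ 2 / 4)) * Z
        ≤ Real.exp (-(u ^ 2 / 4)) * Real.exp (8 * Real.sqrt (ρ + 1)) :=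
          mul_le_mul_of_nonneg_left hZ (Real.exp_pos _).le
      _ = Real.exp (-(u ^ 2 / 4) + 8 * Real.sqrt (ρ + 1)) := by rw [Real.exp_add]
      _ ≤ Real.exp ((8 + b ^ 2) + -(u / 8)) := Real.exp_le_exp.2 (by
          nlinarith [sq_nonneg (u / 2 - b)])
      _ = Real.exp (8 + b ^ 2) * Real.exp (-(u / 8)) := by rw [Real.exp_add]
      _ ≤ Real.exp (8 + b ^ 2) * Real.exp (-c * u) :=
          mul_le_mul_of_nonneg_left hcu (Real.exp_pos _).le
  have hK' : Real.exp (-(u ^ 2 / 2)) * Z ≤ Real.exp (8 + b ^ 2) * Real.exp (-c * u) := by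
    refine le_trans ?_ hK
    exact mul_le_mul_of_nonneg_right (Real.exp_le_exp.2 (by nlinarith)) hZ0
  -- the first term
  have h1 : C₁ * Real.exp (-(c₁ / 2) * u) * A ≤ C₁ * (64 * B / c₁ ^ 2 + 1) * Real.exp (-c * u) := by
    have hsplit : Real.exp (-(c₁ / 2) * u) = Real.exp (-(a * u)) * Real.exp (-(a * u)) := by
      rw [← Real.exp_add, ha]; ring_nf
    have hA1 : A ≤ 2 * B * u ^ 2 + 1 := by linarith
    have hpoly : (2 * B * u ^ 2 + 1) * Real.exp (-(a * u)) ≤ 64 * B / c₁ ^ 2 + 1 := by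
      have h := sq_mul_exp_neg_mul_le ha0 hu
      have he1 : Real.exp (-(a * u)) ≤ 1 := Real.exp_le_one_iff.2 (by nlinarith)
      have ha2 : 2 / a ^ 2 = 32 / c₁ ^ 2 := by rw [ha]; field_simp; norm_num
      calc (2 * B * u ^ 2 + 1) * Real.exp (-(a * u))
          = 2 * B * (u ^ 2 * Real.exp (-(a * u))) + Real.exp (-(a * u)) := by ring
        _ ≤ 2 * B * (2 / a ^ 2) + 1 := add_le_add (mul_le_mul_of_nonneg_left h (by positivity)) he1
        _ = 64 * B / c₁ ^ 2 + 1 := by rw [ha2]; ring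
    have hA0 : 0 ≤ (2 * B * u ^ 2 + 1) * Real.exp (-(a * u)) := by positivity
    calc C₁ * Real.exp (-(c₁ / 2) * u) * A
        = C₁ * ((A * Real.exp (-(a * u))) * Real.exp (-(a * u))) := by rw [hsplit]; ring
      _ ≤ C₁ * (((2 * B * u ^ 2 + 1) * Real.exp (-(a * u))) * Real.exp (-c * u)) := by
          refine mul_le_mul_of_nonneg_left (mul_le_mul ?_ hau (Real.exp_pos _).le hA0) hC₁
          exact mul_le_mul_of_nonneg_right hA1 (Real.exp_pos _).le
      _ ≤ C₁ * ((64 * B / c₁ ^ 2 + 1) * Real.exp (-c * u)) :=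
          mul_le_mul_of_nonneg_left (mul_le_mul_of_nonneg_right hpoly (Real.exp_pos _).le) hC₁
      _ = C₁ * (64 * B / c₁ ^ 2 + 1) * Real.exp (-c * u) := by ring
  have h2 : (C₀ + 1) * Real.exp (-(u ^ 2 / 4)) * Z ≤
      (C₀ + 1) * (Real.exp (8 + b ^ 2) * Real.exp (-c * u)) := by
    rw [mul_assoc]
    exact mul_le_mul_of_nonneg_left hK (by positivity)
  calc C₁ * Real.exp (-(c₁ / 2) * u) * A + (C₀ + 1) * Real.exp (-(u ^ 2 / 4)) * Z +
        Real.exp (-(u ^ 2 / 2)) * Z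
      ≤ C₁ * (64 * B / c₁ ^ 2 + 1) * Real.exp (-c * u) +
          (C₀ + 1) * (Real.exp (8 + b ^ 2) * Real.exp (-c * u)) +
          Real.exp (8 + b ^ 2) * Real.exp (-c * u) := add_le_add (add_le_add h1 h2) hK'
    _ = (C₁ * (64 * B / c₁ ^ 2 + 1) + (C₀ + 2) * Real.exp (8 + b ^ 2)) * Real.exp (-c * u) := by
        ring

/-! ### The termwise bound and its sum -/

/-- For `1 ≤ m ≤ R`: `f_k(m)/m · |M₁(R/m) - 1| ≤ C₁ e^{-(c₁/2)√log R} f_k(m)/m +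
(C₀+1) R^{-1/4} f_k(m) m^{-1/2}` (the first bound when `m ≤ √R`, since then
`log(R/m) ≥ (log R)/2`; the second when `m > √R`, since then `1/m ≤ R^{-1/4} m^{-1/2}`).
[folklore] -/
theorem abs_fCop_mul_sub_one_le {k : ℕ} {R c₁ C₁ C₀ : ℝ} (hR : 1 ≤ R) (hc₁ : 0 < c₁)
    (hC₁ : 0 ≤ C₁)
    (hM₁ : ∀ u : ℝ, 1 ≤ u → |moebiusLogSum u - 1| ≤ C₁ * Real.exp (-(c₁ * Real.sqrt (Real.log u))))
    (hM₀ : ∀ u : ℝ, |moebiusLogSum u| ≤ C₀) {m : ℕ} (hm : m ∈ Icc 1 ⌊R⌋₊) :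
    |fCop k m / m * (moebiusLogSum (R / m) - 1)| ≤
      C₁ * Real.exp (-(c₁ / 2) * Real.sqrt (Real.log R)) * (fCop k m / m) +
        (C₀ + 1) * R ^ (-(1 / 4 : ℝ)) * (fCop k m * (m : ℝ) ^ (-(1 / 2 : ℝ))) := by
  have hR0 : 0 < R := by linarith
  have hL0 : 0 ≤ Real.log R := Real.log_nonneg hR
  have huL : Real.sqrt (Real.log R) ^ 2 = Real.log R := Real.sq_sqrt hL0
  have hC₀ : 0 ≤ C₀ := le_trans (abs_nonneg _) (hM₀ 0)
  obtain ⟨hm1, hmN⟩ := mem_Icc.1 hm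
  have hm0 : (0 : ℝ) < m := by exact_mod_cast hm1
  have hmR : (m : ℝ) ≤ R := le_trans (by exact_mod_cast hmN) (Nat.floor_le hR0.le)
  have hRm : 1 ≤ R / m := by rwa [le_div_iff₀ hm0, one_mul]
  have hf := fCop_nonneg_le_one k m
  have hf0 : 0 ≤ fCop k m := hf.1
  have hfm : 0 ≤ fCop k m / m := div_nonneg hf0 hm0.le
  have hX0 : 0 ≤ C₁ * Real.exp (-(c₁ / 2) * Real.sqrt (Real.log R)) * (fCop k m / m) := by
    positivity
  have hY0 : 0 ≤ (C₀ + 1) * R ^ (-(1 / 4 : ℝ)) * (fCop k m * (m : ℝ) ^ (-(1 / 2 : ℝ))) := by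
    positivity
  rw [abs_mul, abs_of_nonneg hfm]
  rcases le_or_gt (m : ℝ) (Real.sqrt R) with hms | hms
  · -- `m ≤ √R`: `log(R/m) ≥ (log R)/2`
    have hlogm : Real.log m ≤ Real.log R / 2 := by
      calc Real.log m ≤ Real.log (Real.sqrt R) := Real.log_le_log hm0 hms
        _ = Real.log R / 2 := Real.log_sqrt hR0.le
    have hlogRm : Real.log R / 2 ≤ Real.log (R / m) := by
      rw [Real.log_div hR0.ne' hm0.ne']; linarith
    have hsq : Real.sqrt (Real.log R) / 2 ≤ Real.sqrt (Real.log (R / m)) := by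
      calc Real.sqrt (Real.log R) / 2 ≤ Real.sqrt (Real.log R / 2) :=
            Real.le_sqrt_of_sq_le (by rw [div_pow, huL]; linarith)
        _ ≤ Real.sqrt (Real.log (R / m)) := Real.sqrt_le_sqrt hlogRm
    have hb1 := hM₁ (R / m) hRm
    have hexp : Real.exp (-(c₁ * Real.sqrt (Real.log (R / m)))) ≤
        Real.exp (-(c₁ / 2) * Real.sqrt (Real.log R)) :=
      Real.exp_le_exp.2 (by nlinarith)
    calc fCop k m / m * |moebiusLogSum (R / m) - 1|
        ≤ fCop k m / m * (C₁ * Real.exp (-(c₁ / 2) * Real.sqrt (Real.log R))) :=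
          mul_le_mul_of_nonneg_left (hb1.trans (mul_le_mul_of_nonneg_left hexp hC₁)) hfm
      _ = C₁ * Real.exp (-(c₁ / 2) * Real.sqrt (Real.log R)) * (fCop k m / m) := by ring
      _ ≤ _ := le_add_of_nonneg_right hY0
  · -- `m > √R`: `|M₁ - 1| ≤ C₀ + 1` and `1/m ≤ R^{-1/4} m^{-1/2}`
    have hb2 : |moebiusLogSum (R / m) - 1| ≤ C₀ + 1 := by
      calc |moebiusLogSum (R / m) - 1| ≤ |moebiusLogSum (R / m)| + |(1 : ℝ)| := abs_sub _ _
        _ ≤ C₀ + 1 := by rw [abs_one]; exact add_le_add (hM₀ _) le_rfl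
    have hinv : (m : ℝ)⁻¹ ≤ R ^ (-(1 / 4 : ℝ)) * (m : ℝ) ^ (-(1 / 2 : ℝ)) := by
      have hsR : 0 < Real.sqrt R := Real.sqrt_pos.2 hR0
      have hmono : (m : ℝ) ^ (-(1 / 2 : ℝ)) ≤ (Real.sqrt R) ^ (-(1 / 2 : ℝ)) :=
        Real.rpow_le_rpow_of_nonpos hsR hms.le (by norm_num)
      have hRR : (Real.sqrt R) ^ (-(1 / 2 : ℝ)) = R ^ (-(1 / 4 : ℝ)) := by
        rw [Real.sqrt_eq_rpow, ← Real.rpow_mul hR0.le]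
        norm_num
      rw [inv_eq_rpow_mul_rpow hm0]
      rw [hRR] at hmono
      exact mul_le_mul_of_nonneg_right hmono (by positivity)
    have hprod0 : 0 ≤ fCop k m * (R ^ (-(1 / 4 : ℝ)) * (m : ℝ) ^ (-(1 / 2 : ℝ))) := by positivity
    calc fCop k m / m * |moebiusLogSum (R / m) - 1|
        ≤ fCop k m * (R ^ (-(1 / 4 : ℝ)) * (m : ℝ) ^ (-(1 / 2 : ℝ))) * (C₀ + 1) := by
          refine mul_le_mul ?_ hb2 (abs_nonneg _) hprod0
          rw [div_eq_mul_inv]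
          exact mul_le_mul_of_nonneg_left hinv hf0
      _ = (C₀ + 1) * R ^ (-(1 / 4 : ℝ)) * (fCop k m * (m : ℝ) ^ (-(1 / 2 : ℝ))) := by ring
      _ ≤ _ := le_add_of_nonneg_left hX0

/-- Summing the termwise bound: for `k ≥ 1`, `R ≥ 1`,
`|Σ_{m ≤ R} f_k(m)/m (M₁(R/m) - 1)| ≤ C₁ e^{-(c₁/2)√log R} Σ_{m ≤ R} f_k(m)/m + (C₀+1) R^{-1/4} Z_k`,
`Z_k = ∏_{p ∣ k}(1 - p^{-1/2})⁻¹ ≥ Σ_{m ≤ R} f_k(m) m^{-1/2}`. [folklore] -/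
theorem abs_sum_fCop_mul_sub_one_le {k : ℕ} (hk : k ≠ 0) {R c₁ C₁ C₀ : ℝ} (hR : 1 ≤ R)
    (hc₁ : 0 < c₁) (hC₁ : 0 ≤ C₁)
    (hM₁ : ∀ u : ℝ, 1 ≤ u → |moebiusLogSum u - 1| ≤ C₁ * Real.exp (-(c₁ * Real.sqrt (Real.log u))))
    (hM₀ : ∀ u : ℝ, |moebiusLogSum u| ≤ C₀) :
    |∑ m ∈ Icc 1 ⌊R⌋₊, fCop k m / m * (moebiusLogSum (R / m) - 1)| ≤
      C₁ * Real.exp (-(c₁ / 2) * Real.sqrt (Real.log R)) * (∑ m ∈ Icc 1 ⌊R⌋₊, fCop k m / m) +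
        (C₀ + 1) * R ^ (-(1 / 4 : ℝ)) *
          ∏ p ∈ k.primeFactors, (1 - (p : ℝ) ^ (-(1 / 2 : ℝ)))⁻¹ := by
  have hR0 : 0 < R := by linarith
  have hC₀ : 0 ≤ C₀ := le_trans (abs_nonneg _) (hM₀ 0)
  set N := ⌊R⌋₊ with hN
  have hsumZ : ∑ m ∈ Icc 1 N, fCop k m * (m : ℝ) ^ (-(1 / 2 : ℝ)) ≤
      ∏ p ∈ k.primeFactors, (1 - (p : ℝ) ^ (-(1 / 2 : ℝ)))⁻¹ :=
    sum_le_hasSum (Icc 1 N) (fun m _ => mul_nonneg (fCop_nonneg_le_one k m).1 (by positivity))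
      (hasSum_fCop_mul_rpow hk (by norm_num))
  calc |∑ m ∈ Icc 1 N, fCop k m / m * (moebiusLogSum (R / m) - 1)|
      ≤ ∑ m ∈ Icc 1 N, |fCop k m / m * (moebiusLogSum (R / m) - 1)| := abs_sum_le_sum_abs _ _
    _ ≤ ∑ m ∈ Icc 1 N, (C₁ * Real.exp (-(c₁ / 2) * Real.sqrt (Real.log R)) * (fCop k m / m) +
          (C₀ + 1) * R ^ (-(1 / 4 : ℝ)) * (fCop k m * (m : ℝ) ^ (-(1 / 2 : ℝ)))) :=
        sum_le_sum fun m hm => abs_fCop_mul_sub_one_le hR hc₁ hC₁ hM₁ hM₀ hm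
    _ = C₁ * Real.exp (-(c₁ / 2) * Real.sqrt (Real.log R)) * (∑ m ∈ Icc 1 N, fCop k m / m) +
          (C₀ + 1) * R ^ (-(1 / 4 : ℝ)) * ∑ m ∈ Icc 1 N, fCop k m * (m : ℝ) ^ (-(1 / 2 : ℝ)) := by
        rw [sum_add_distrib, ← mul_sum, ← mul_sum]
    _ ≤ _ := by gcongr

end GoldstonYildirimLemma21

/-! ### The theorem -/

open Finset GoldstonYildirimLemma21 CoprimeMoebius GreenTao2008 in
open scoped ArithmeticFunction.Moebius in
/-- **Goldston–Yıldırım I, Lemma 2.1, (2.11)–(2.12) at `j = 0`, PROVED**: there is an absolute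
`c > 0` such that for every `B > 0` there is `C` with
`|Σ_{d ≤ R, (d,k)=1} μ(d)/d · log(R/d) - k/φ(k)| ≤ C exp(-c√log R)` for all `k ≥ 1`, `R ≥ 1`,
`k ≤ R^B`. Elementary proof through `μ·𝟙_{(·,k)=1} = f_k ⋆ μ`, the tree's
`Σ_{n ≤ x} μ(n) log(x/n)/n = 1 + O(exp(-c₁√log x))` and Rankin bounds for the `k`-factored
numbers (see the section docstring); the source argues by contour integration.
[cite: GoldstonYildirim2001, Lemma 2.1 (2.11)–(2.12) with j = 0, pp. 13, 15–18] -/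
theorem goldstonYildirim_lemma21_log_j0_holds : goldstonYildirim_lemma21_log_j0 := by
  unfold goldstonYildirim_lemma21_log_j0
  obtain ⟨c₁, hc₁, C₁, hC₁, hM₁⟩ := exists_abs_moebiusLogSum_sub_one_le_of_one_le
  obtain ⟨C₀, hC₀, hM₀⟩ := exists_abs_moebiusLogSum_le
  refine ⟨min (c₁ / 4) (1 / 8), lt_min (by positivity) (by norm_num), fun B hB => ?_⟩
  refine ⟨C₁ * (64 * B / c₁ ^ 2 + 1) +
      (C₀ + 2) * Real.exp (8 + (8 * Real.sqrt (2 * B) + 1 / 8) ^ 2), fun k hk R hR hkR => ?_⟩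
  have hk0 : k ≠ 0 := by omega
  have hR0 : 0 < R := by linarith
  have hL0 : 0 ≤ Real.log R := Real.log_nonneg hR
  have huL : Real.sqrt (Real.log R) ^ 2 = Real.log R := Real.sq_sqrt hL0
  have hP : ∀ p ∈ k.primeFactors, p.Prime := fun p hp => Nat.prime_of_mem_primeFactors hp
  -- sizes of `ω(k)`, `k/φ(k)`, `Σ f_k(m)/m`, `Z_k`
  have hρ : (k.primeFactors.card : ℝ) ≤ 2 * B * Real.sqrt (Real.log R) ^ 2 := by
    rw [huL]
    exact card_primeFactors_le_of_le_rpow hk0 hR0 hkR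
  have hΦle : (k : ℝ) / k.totient ≤ k.primeFactors.card + 1 := by
    rw [cast_div_totient_eq_prod hk0]
    exact prod_inv_one_sub_inv_le_card _ hP
  have hAΦ : ∑ m ∈ Icc 1 ⌊R⌋₊, fCop k m / m ≤ (k : ℝ) / k.totient := sum_fCop_div_le hk0 _
  have hZle : ∏ p ∈ k.primeFactors, (1 - (p : ℝ) ^ (-(1 / 2 : ℝ)))⁻¹ ≤
      Real.exp (8 * Real.sqrt (k.primeFactors.card + 1)) := prod_inv_one_sub_rpow_le_exp _ hP
  have hZ0 : 0 ≤ ∏ p ∈ k.primeFactors, (1 - (p : ℝ) ^ (-(1 / 2 : ℝ)))⁻¹ :=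
    prod_nonneg fun p hp => by
      have hp2 : (2 : ℝ) ≤ p := by exact_mod_cast (hP p hp).two_le
      have h1 : (p : ℝ) ^ (-(1 / 2 : ℝ)) < 1 :=
        Real.rpow_lt_one_of_one_lt_of_neg (by linarith) (by norm_num)
      exact inv_nonneg.2 (by linarith)
  -- the two estimates
  have hT := div_totient_sub_sum_le hk0 hR
  have hE := abs_sum_fCop_mul_sub_one_le hk0 hR hc₁ hC₁ hM₁ hM₀
  -- powers of `R` as exponentials in `u = √log R`
  have hR12 : R ^ (-(1 / 2 : ℝ)) = Real.exp (-(Real.sqrt (Real.log R) ^ 2 / 2)) := by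
    rw [Real.rpow_def_of_pos hR0, huL]; ring_nf
  have hR14 : R ^ (-(1 / 4 : ℝ)) = Real.exp (-(Real.sqrt (Real.log R) ^ 2 / 4)) := by
    rw [Real.rpow_def_of_pos hR0, huL]; ring_nf
  have hnum := error_terms_le hc₁ (Real.sqrt_nonneg _) hB.le hC₁ hC₀ hAΦ hΦle hρ hZ0 hZle
    (min_le_left (c₁ / 4) (1 / 8)) (min_le_right _ _)
  rw [← hR12, ← hR14] at hnum
  -- the identity, the decomposition, the conclusion
  rw [sum_coprime_moebius_log_eq_sum_fCop k R]
  have hdecomp : ∑ m ∈ Icc 1 ⌊R⌋₊, fCop k m / m * moebiusLogSum (R / m) - (k : ℝ) / k.totient =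
      ∑ m ∈ Icc 1 ⌊R⌋₊, fCop k m / m * (moebiusLogSum (R / m) - 1) +
        (∑ m ∈ Icc 1 ⌊R⌋₊, fCop k m / m - (k : ℝ) / k.totient) := by
    have h1 : ∑ m ∈ Icc 1 ⌊R⌋₊, fCop k m / m * (moebiusLogSum (R / m) - 1) =
        ∑ m ∈ Icc 1 ⌊R⌋₊, fCop k m / m * moebiusLogSum (R / m) -
          ∑ m ∈ Icc 1 ⌊R⌋₊, fCop k m / m := by
      rw [← sum_sub_distrib]
      exact sum_congr rfl fun m _ => by ring
    rw [h1]; ring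
  rw [hdecomp]
  calc |∑ m ∈ Icc 1 ⌊R⌋₊, fCop k m / m * (moebiusLogSum (R / m) - 1) +
        (∑ m ∈ Icc 1 ⌊R⌋₊, fCop k m / m - (k : ℝ) / k.totient)|
      ≤ |∑ m ∈ Icc 1 ⌊R⌋₊, fCop k m / m * (moebiusLogSum (R / m) - 1)| +
          |∑ m ∈ Icc 1 ⌊R⌋₊, fCop k m / m - (k : ℝ) / k.totient| := abs_add_le _ _
    _ = |∑ m ∈ Icc 1 ⌊R⌋₊, fCop k m / m * (moebiusLogSum (R / m) - 1)| +
          ((k : ℝ) / k.totient - ∑ m ∈ Icc 1 ⌊R⌋₊, fCop k m / m) := by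
        rw [abs_of_nonpos (sub_nonpos.2 hAΦ), neg_sub]
    _ ≤ C₁ * Real.exp (-(c₁ / 2) * Real.sqrt (Real.log R)) * (∑ m ∈ Icc 1 ⌊R⌋₊, fCop k m / m) +
          (C₀ + 1) * R ^ (-(1 / 4 : ℝ)) * ∏ p ∈ k.primeFactors, (1 - (p : ℝ) ^ (-(1 / 2 : ℝ)))⁻¹ +
          R ^ (-(1 / 2 : ℝ)) * ∏ p ∈ k.primeFactors, (1 - (p : ℝ) ^ (-(1 / 2 : ℝ)))⁻¹ :=
        add_le_add hE hT
    _ ≤ _ := hnum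

/-! ## Proof of (2.13) at `j = 1` (`goldstonYildirim_lemma21_j1_holds`)

Everything below is PROVED ((2.13) at `j = 0`, `goldstonYildirim_lemma21_j0_holds`, lives in the
sibling `GoldstonYildirimLemma21MoebiusSumProofs.lean`, by a split at `√R` and the
`GreenTao2008.SharpGY` Rankin machinery). For (2.13) the source argues by Perron's formula and the
zero-free region (pp. 17–18: `∑_{d ≤ R,(d,k)=1} μ(d)/φ_j(d) = (2πi)⁻¹ ∫ F(s) R^s ds/s + O(log²R/T)`,
no residue at `s = 0`). Here there is no main term and no power saving to spare, so the bookkeeping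
in `k` has to be as sharp as the paper's (3.5), `|g_k(s)| ≪ exp((log k)^{1/4})`: this is done once
and for all in `CoprimeMoebiusHarmonicDecay.lean`, whose main result
(`CoprimeMoebiusDecay.abs_sum_coprimeMoebiusInv_le`) is the uniform bound

  `|M_k(N)| = |∑_{n ≤ N, (n,k)=1} μ(n)/n| ≤ C e^{4 P(k)} e^{-c₀√log N}`,
  `P(k) = ∑_{p ∣ k} p^{-3/4}`,

from `μ·𝟙_{(·,k)=1}/id = (𝟙_{k^∞}/id) ⋆ (μ/id)`, the tree's `∑_{n ≤ x} μ(n)/n ≪ exp(-c₀√log x)`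
(`Literature.NumberTheory.LFunctions.abs_sum_moebius_div_le_exp_neg_sqrt_log`) and Rankin's
trick with the weight `m^{1/4}`; together with `P(k) ≤ (4 + 2B)(log R + 1)^{1/4}` for `k ≤ R^B`
(ibid., `primeSum_le_of_le_rpow`: `ω(k) ≤ 2B log R` and `∑_{n ≤ T} n^{-3/4} ≤ 4T^{1/4}` with
`T ≍ log R`) and
`K (log R + 1)^{1/4} ≤ (c₀/2)√(log R + 1) + K²/(2c₀)` (`exists_final_bound`) this would already
give (2.13) at `j = 0` with `c = c₀/2` and no splitting of the range. For `j = 1` (`φ₁ = φ`) the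
multiplicative identity

  `μ·𝟙_{(·,k)=1}/φ = H_k ⋆ (μ·𝟙_{(·,k)=1}/id)`,  `H_k(p^i) = -p^{-i}/(p-1)` (`p ∤ k`), `0` (`p ∣ k`)

(`eq_mul_coprimeMoebiusInvAF`, compared at prime powers) gives
`∑_{d ≤ N,(d,k)=1} μ(d)/φ(d) = ∑_{j ≤ N} H_k(j) M_k(⌊N/j⌋)`; the bound for `M_k`, the key decay
inequality `e^{-c₀√log⌊N/j⌋} ≤ e^{c₀²}(2j)^{1/4} e^{-c₀√log N}` and the absolutely convergent Euler
product `∑_j |H_k(j)| j^{1/4} ≤ ∑_j j^{-3/4} ∏_{p ∣ j}(p-1)⁻¹ ≤ exp(8 ∑_n n^{-7/4})`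
(`CoprimeMoebiusDecay.sum_majorant_le`) give the same shape of bound
(`abs_sum_coprime_moebius_div_totient_le`), whence (2.13) at `j = 1`
(`goldstonYildirim_lemma21_j1_holds`). The helper statements are phrased for arbitrary arithmetic
functions `T`, `H` with the displayed values (hypotheses `hT`, `hH`), so that no auxiliary
definition is introduced. -/

namespace GoldstonYildirimLemma21

open Finset Real ArithmeticFunction Literature.NumberTheory.LFunctions.PlateauMollifier

open scoped ArithmeticFunction.Moebius

/-! ### `μ·𝟙_{(·,k)=1}/φ = H_k ⋆ (μ·𝟙_{(·,k)=1}/id)` with `H_k` multiplicative and small -/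

section Convolution

variable {k : ℕ} {T H : ArithmeticFunction ℝ}

/-- `μ·𝟙_{(·,k)=1}/φ` (any arithmetic function `T` with these values) is multiplicative.
[folklore] -/
theorem isMultiplicative_of_eq_tot
    (hT : ∀ n : ℕ, T n = if n.Coprime k then (μ n : ℝ) / (Nat.totient n : ℝ) else 0) :
    T.IsMultiplicative := by
  refine ⟨by simp [hT], fun {m n} hmn => ?_⟩
  simp only [hT]
  by_cases hm : m.Coprime k <;> by_cases hn : n.Coprime k
  · rw [if_pos (Nat.Coprime.mul_left hm hn), if_pos hm, if_pos hn,
      ArithmeticFunction.isMultiplicative_moebius.map_mul_of_coprime hmn, Int.cast_mul,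
      Nat.totient_mul hmn, Nat.cast_mul, div_mul_div_comm]
  · rw [if_neg (fun h => hn (Nat.Coprime.coprime_mul_left h)), if_neg hn, mul_zero]
  · rw [if_neg (fun h => hm (Nat.Coprime.coprime_mul_right h)), if_neg hm, zero_mul]
  · rw [if_neg (fun h => hm (Nat.Coprime.coprime_mul_right h)), if_neg hm, zero_mul]

/-- `H_k(n) = [(n,k)=1] · n⁻¹ ∏_{p ∣ n} (-(p-1)⁻¹)` — the multiplicative function with
`H_k(p^i) = -p^{-i}/(p-1)` (`p ∤ k`, `i ≥ 1`) and `H_k(p^i) = 0` (`p ∣ k`), i.e. the Dirichlet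
coefficients of `∏_{p ∤ k} (1 - 1/((p-1)p^s)) / ∏_{p ∤ k} (1 - p^{-1-s})` — is multiplicative
(any arithmetic function `H` with these values). [folklore] -/
theorem isMultiplicative_of_eq_h
    (hH : ∀ n : ℕ, H n =
      if n.Coprime k then (n : ℝ)⁻¹ * ∏ p ∈ n.primeFactors, (-((p : ℝ) - 1)⁻¹) else 0) :
    H.IsMultiplicative := by
  refine ⟨by simp [hH], fun {m n} hmn => ?_⟩
  simp only [hH]
  by_cases hm : m.Coprime k <;> by_cases hn : n.Coprime k
  · rw [if_pos (Nat.Coprime.mul_left hm hn), if_pos hm, if_pos hn]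
    rcases Nat.eq_zero_or_pos m with rfl | hm0
    · simp
    rcases Nat.eq_zero_or_pos n with rfl | hn0
    · simp
    rw [Nat.Coprime.primeFactors_mul hmn, Finset.prod_union hmn.disjoint_primeFactors, Nat.cast_mul,
      mul_inv]
    ring
  · rw [if_neg (fun h => hn (Nat.Coprime.coprime_mul_left h)), if_neg hn, mul_zero]
  · rw [if_neg (fun h => hm (Nat.Coprime.coprime_mul_right h)), if_neg hm, zero_mul]
  · rw [if_neg (fun h => hm (Nat.Coprime.coprime_mul_right h)), if_neg hm, zero_mul]

/-- **`μ·1_{(·,k)=1}/φ = H_k ⋆ (μ·1_{(·,k)=1}/id)`** (both sides are multiplicative; compare at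
prime powers: for `p ∣ k` both vanish, for `p ∤ k` one has `-1/(p-1) = -1/(p(p-1)) - 1/p` at `p`
and `0 = -p^{-i}/(p-1) + p^{-(i-1)}/(p-1) · 1/p` at `p^i`, `i ≥ 2`). [folklore] -/
theorem eq_mul_coprimeMoebiusInvAF
    (hT : ∀ n : ℕ, T n = if n.Coprime k then (μ n : ℝ) / (Nat.totient n : ℝ) else 0)
    (hH : ∀ n : ℕ, H n =
      if n.Coprime k then (n : ℝ)⁻¹ * ∏ p ∈ n.primeFactors, (-((p : ℝ) - 1)⁻¹) else 0) :
    T = H * coprimeMoebiusInvAF k := by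
  have hTm := isMultiplicative_of_eq_tot hT
  have hHm := isMultiplicative_of_eq_h hH
  rw [ArithmeticFunction.IsMultiplicative.eq_iff_eq_on_prime_powers _ hTm _
    (hHm.mul (isMultiplicative_coprimeMoebiusInvAF k))]
  intro p i hp
  rcases Nat.eq_zero_or_pos i with rfl | hi
  · rw [pow_zero, hTm.map_one, (hHm.mul (isMultiplicative_coprimeMoebiusInvAF k)).map_one]
  obtain ⟨n, rfl⟩ : ∃ n, i = n + 1 := ⟨i - 1, by omega⟩
  have hp0 : 0 < p := hp.pos
  have hpR : (p : ℝ) ≠ 0 := by exact_mod_cast hp.ne_zero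
  have hp1R : (p : ℝ) - 1 ≠ 0 := by
    have : (2 : ℝ) ≤ p := by exact_mod_cast hp.two_le
    linarith
  rw [ArithmeticFunction.mul_apply,
    Nat.sum_divisorsAntidiagonal' (fun a b => H a * coprimeMoebiusInvAF k b),
    Nat.sum_divisors_prime_pow hp, Finset.sum_range_succ', Finset.sum_range_succ']
  have hrest : ∑ x ∈ Finset.range n,
      H (p ^ (n + 1) / p ^ (x + 1 + 1)) * coprimeMoebiusInvAF k (p ^ (x + 1 + 1)) = 0 := by
    refine Finset.sum_eq_zero fun x _ => ?_
    rw [coprimeMoebiusInvAF_apply, ArithmeticFunction.moebius_apply_prime_pow hp (by omega),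
      if_neg (show x + 1 + 1 ≠ 1 by omega)]
    simp
  have hdiv : p ^ (n + 1) / p = p ^ n := by rw [pow_succ, Nat.mul_div_cancel _ hp0]
  rw [hrest, zero_add, pow_zero, Nat.div_one, pow_one, hdiv]
  -- values at prime powers
  have hcop_pow : ∀ j : ℕ, (p ^ (j + 1)).Coprime k ↔ ¬p ∣ k := fun j => by
    rw [Nat.coprime_pow_left_iff (Nat.succ_pos j), Nat.Prime.coprime_iff_not_dvd hp]
  have hpf : ∀ j : ℕ, (p ^ (j + 1)).primeFactors = {p} := fun j =>
    Nat.primeFactors_prime_pow (Nat.succ_ne_zero j) hp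
  have hcM1 : coprimeMoebiusInvAF k 1 = 1 := by simp
  have hcMp : coprimeMoebiusInvAF k p = if ¬p ∣ k then -(p : ℝ)⁻¹ else 0 := by
    rw [coprimeMoebiusInvAF_apply, ArithmeticFunction.moebius_apply_prime hp]
    simp only [Nat.Prime.coprime_iff_not_dvd hp]
    split_ifs <;> simp [div_eq_mul_inv]
  have hHp : ∀ j : ℕ, H (p ^ (j + 1)) =
      if ¬p ∣ k then ((p : ℝ) ^ (j + 1))⁻¹ * (-((p : ℝ) - 1)⁻¹) else 0 := fun j => by
    simp only [hH, hcop_pow, hpf, Finset.prod_singleton, Nat.cast_pow]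
  have hTp : ∀ j : ℕ, T (p ^ (j + 1)) =
      if ¬p ∣ k then (μ (p ^ (j + 1)) : ℝ) / (Nat.totient (p ^ (j + 1)) : ℝ) else 0 := fun j => by
    simp only [hT, hcop_pow]
  by_cases hpk : p ∣ k
  · rw [hTp, hHp, hcMp, if_neg (not_not.2 hpk), if_neg (not_not.2 hpk), if_neg (not_not.2 hpk)]
    ring
  · rw [hTp, hHp, hcMp, hcM1, if_pos hpk, if_pos hpk, if_pos hpk]
    rcases Nat.eq_zero_or_pos n with rfl | hn
    · simp only [pow_zero, zero_add, pow_one]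
      rw [hHm.map_one, ArithmeticFunction.moebius_apply_prime hp, Nat.totient_prime hp,
        Nat.cast_sub hp.one_lt.le]
      push_cast
      field_simp
      ring
    · obtain ⟨m, rfl⟩ : ∃ m, n = m + 1 := ⟨n - 1, by omega⟩
      rw [hHp, if_pos hpk, ArithmeticFunction.moebius_apply_prime_pow hp (by omega),
        if_neg (show m + 1 + 1 ≠ 1 by omega)]
      push_cast
      field_simp
      ring

/-- `|H_k(n)| ≤ n⁻¹ ∏_{p ∣ n} (p-1)⁻¹`. [folklore] -/
theorem abs_le_of_eq_h
    (hH : ∀ n : ℕ, H n =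
      if n.Coprime k then (n : ℝ)⁻¹ * ∏ p ∈ n.primeFactors, (-((p : ℝ) - 1)⁻¹) else 0) (n : ℕ) :
    |H n| ≤ (n : ℝ)⁻¹ * ∏ p ∈ n.primeFactors, ((p : ℝ) - 1)⁻¹ := by
  have hfac : ∀ p ∈ n.primeFactors, (0 : ℝ) ≤ ((p : ℝ) - 1)⁻¹ := fun p hp => by
    have : (2 : ℝ) ≤ p := by exact_mod_cast (Nat.prime_of_mem_primeFactors hp).two_le
    exact inv_nonneg.2 (by linarith)
  rw [hH]
  split_ifs with h
  · rw [abs_mul, abs_of_nonneg (inv_nonneg.2 (Nat.cast_nonneg n)), Finset.abs_prod]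
    refine mul_le_mul_of_nonneg_left (le_of_eq (Finset.prod_congr rfl fun p hp => ?_))
      (inv_nonneg.2 (Nat.cast_nonneg n))
    rw [abs_neg, abs_of_nonneg (hfac p hp)]
  · rw [abs_zero]
    exact mul_nonneg (inv_nonneg.2 (Nat.cast_nonneg n)) (Finset.prod_nonneg hfac)

end Convolution

/-! ### The sum `∑_{d ≤ N, (d,k)=1} μ(d)/φ(d)` and the final numerical step -/

/-- **Core bound at `j = 1`.** If `|M(J)| ≤ C₁ e^{-c₀√log J}` for all `J`, then for all `k ≠ 0`
and all `N`, with `Z = exp(8 ∑_n n^{-7/4})`,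
`|∑_{d ≤ N, (d,k)=1} μ(d)/φ(d)| ≤ C₁ e^{2c₀²} 2^{1/2} Z · exp(4 P(k)) · exp(-c₀ √log N)`:
`∑_{d ≤ N} μ_k(d)/φ(d) = ∑_{j ≤ N} H_k(j) M_k(⌊N/j⌋)`, the `j = 0` bound for `M_k`, the key decay
inequality once more, and `∑_j |H_k(j)| (2j)^{1/4} ≤ 2^{1/4} ∑_j h(j) ≤ 2^{1/4} Z`. [folklore] -/
theorem abs_sum_coprime_moebius_div_totient_le {c₀ C₁ : ℝ} (hc : 0 < c₀) (hC : 0 ≤ C₁)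
    (hM : ∀ J : ℕ, |moebiusInvSum J| ≤ C₁ * Real.exp (-c₀ * Real.sqrt (Real.log J)))
    {k : ℕ} (hk : k ≠ 0) (N : ℕ) :
    |∑ n ∈ Ioc 0 N, (if n.Coprime k then (μ n : ℝ) / (Nat.totient n : ℝ) else 0)| ≤
      C₁ * Real.exp (c₀ ^ 2) * (2 : ℝ) ^ (1 / 4 : ℝ) * (Real.exp (c₀ ^ 2) * (2 : ℝ) ^ (1 / 4 : ℝ) *
        Real.exp (8 * ∑' n : ℕ, (n : ℝ) ^ (-(7 / 4 : ℝ)))) *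
        Real.exp (4 * ∑ p ∈ k.primeFactors, (p : ℝ) ^ (-(3 / 4 : ℝ))) *
        Real.exp (-c₀ * Real.sqrt (Real.log N)) := by
  -- the two arithmetic functions of §E
  set T : ArithmeticFunction ℝ :=
    ⟨fun n => if n.Coprime k then (μ n : ℝ) / (Nat.totient n : ℝ) else 0, by simp⟩ with hTdef
  set H : ArithmeticFunction ℝ :=
    ⟨fun n => if n.Coprime k then (n : ℝ)⁻¹ * ∏ p ∈ n.primeFactors, (-((p : ℝ) - 1)⁻¹) else 0,
      by simp⟩ with hHdef
  have hT : ∀ n : ℕ, T n = if n.Coprime k then (μ n : ℝ) / (Nat.totient n : ℝ) else 0 :=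
    fun n => rfl
  have hH : ∀ n : ℕ, H n =
      if n.Coprime k then (n : ℝ)⁻¹ * ∏ p ∈ n.primeFactors, (-((p : ℝ) - 1)⁻¹) else 0 :=
    fun n => rfl
  show |∑ n ∈ Ioc 0 N, T n| ≤ _
  rw [eq_mul_coprimeMoebiusInvAF hT hH, ArithmeticFunction.sum_Ioc_mul_eq_sum_sum]
  set E := Real.exp (-c₀ * Real.sqrt (Real.log N)) with hE
  set A := C₁ * Real.exp (c₀ ^ 2) * (2 : ℝ) ^ (1 / 4 : ℝ) with hA
  set Z := Real.exp (8 * ∑' n : ℕ, (n : ℝ) ^ (-(7 / 4 : ℝ))) with hZ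
  set P := Real.exp (4 * ∑ p ∈ k.primeFactors, (p : ℝ) ^ (-(3 / 4 : ℝ))) with hP
  have hA0 : 0 ≤ A := by positivity
  have hE0 : 0 ≤ E := (Real.exp_pos _).le
  have hP0 : 0 ≤ P := (Real.exp_pos _).le
  -- the inner sums
  have hinner : ∀ j ∈ Ioc 0 N, |∑ i ∈ Ioc 0 (N / j), coprimeMoebiusInvAF k i| ≤
      A * P * (Real.exp (c₀ ^ 2) * (2 * (j : ℝ)) ^ (1 / 4 : ℝ) * E) := by
    intro j hj
    rw [Finset.mem_Ioc] at hj
    have h1 := CoprimeMoebiusDecay.abs_sum_coprimeMoebiusInv_le hc hC hM hk (N / j)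
    have hkey := CoprimeMoebiusDecay.exp_neg_sqrt_log_div_le hc hj.1 hj.2
    exact h1.trans (mul_le_mul_of_nonneg_left hkey (by positivity))
  -- termwise bound by the majorant `h(j) = j^{-3/4} ∏_{p ∣ j} (p-1)⁻¹`
  have hterm : ∀ j ∈ Ioc 0 N, |H j * ∑ i ∈ Ioc 0 (N / j), coprimeMoebiusInvAF k i| ≤
      A * P * Real.exp (c₀ ^ 2) * (2 : ℝ) ^ (1 / 4 : ℝ) * E *
        ((j : ℝ) ^ (-(3 / 4 : ℝ)) * ∏ p ∈ j.primeFactors, ((p : ℝ) - 1)⁻¹) := by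
    intro j hj
    have hjR : (0 : ℝ) < j := by exact_mod_cast (Finset.mem_Ioc.1 hj).1
    rw [abs_mul]
    have h2j : (2 * (j : ℝ)) ^ (1 / 4 : ℝ) = (2 : ℝ) ^ (1 / 4 : ℝ) * (j : ℝ) ^ (1 / 4 : ℝ) :=
      Real.mul_rpow (by norm_num) hjR.le
    have hj34 : (j : ℝ)⁻¹ * (j : ℝ) ^ (1 / 4 : ℝ) = (j : ℝ) ^ (-(3 / 4 : ℝ)) := by
      rw [← Real.rpow_neg_one, ← Real.rpow_add hjR]; norm_num
    have hHj := abs_le_of_eq_h hH j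
    have hprod0 : 0 ≤ ∏ p ∈ j.primeFactors, ((p : ℝ) - 1)⁻¹ :=
      Finset.prod_nonneg fun _ hp =>
        (CoprimeMoebiusDecay.inv_sub_one_mem (Nat.prime_of_mem_primeFactors hp)).1
    calc |H j| * |∑ i ∈ Ioc 0 (N / j), coprimeMoebiusInvAF k i|
        ≤ ((j : ℝ)⁻¹ * ∏ p ∈ j.primeFactors, ((p : ℝ) - 1)⁻¹) *
            (A * P * (Real.exp (c₀ ^ 2) * (2 * (j : ℝ)) ^ (1 / 4 : ℝ) * E)) :=
          mul_le_mul hHj (hinner j hj) (abs_nonneg _) (mul_nonneg (inv_nonneg.2 hjR.le) hprod0)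
      _ = A * P * Real.exp (c₀ ^ 2) * (2 : ℝ) ^ (1 / 4 : ℝ) * E *
            (((j : ℝ)⁻¹ * (j : ℝ) ^ (1 / 4 : ℝ)) * ∏ p ∈ j.primeFactors, ((p : ℝ) - 1)⁻¹) := by
          rw [h2j]; ring
      _ = A * P * Real.exp (c₀ ^ 2) * (2 : ℝ) ^ (1 / 4 : ℝ) * E *
            ((j : ℝ) ^ (-(3 / 4 : ℝ)) * ∏ p ∈ j.primeFactors, ((p : ℝ) - 1)⁻¹) := by
          rw [hj34]
  calc |∑ j ∈ Ioc 0 N, H j * ∑ i ∈ Ioc 0 (N / j), coprimeMoebiusInvAF k i|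
      ≤ ∑ j ∈ Ioc 0 N, |H j * ∑ i ∈ Ioc 0 (N / j), coprimeMoebiusInvAF k i| :=
        Finset.abs_sum_le_sum_abs _ _
    _ ≤ ∑ j ∈ Ioc 0 N, A * P * Real.exp (c₀ ^ 2) * (2 : ℝ) ^ (1 / 4 : ℝ) * E *
          ((j : ℝ) ^ (-(3 / 4 : ℝ)) * ∏ p ∈ j.primeFactors, ((p : ℝ) - 1)⁻¹) :=
        Finset.sum_le_sum hterm
    _ = A * P * Real.exp (c₀ ^ 2) * (2 : ℝ) ^ (1 / 4 : ℝ) * E *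
          ∑ j ∈ Ioc 0 N, (j : ℝ) ^ (-(3 / 4 : ℝ)) * ∏ p ∈ j.primeFactors, ((p : ℝ) - 1)⁻¹ := by
        rw [Finset.mul_sum]
    _ ≤ A * P * Real.exp (c₀ ^ 2) * (2 : ℝ) ^ (1 / 4 : ℝ) * E * Z :=
        mul_le_mul_of_nonneg_left (CoprimeMoebiusDecay.sum_majorant_le N) (by positivity)
    _ = A * (Real.exp (c₀ ^ 2) * (2 : ℝ) ^ (1 / 4 : ℝ) * Z) * P * E := by ring

/-- **The final numerical step**: for `1 ≤ k ≤ R^B`, `R ≥ 1`,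
`A exp(4 P(k)) exp(-c₀ √log ⌊R⌋) ≤ A e^{D} exp(-(c₀/2) √log R)` with `D = D(c₀, B)`, by
`4 P(k) ≤ K (log R + 1)^{1/4} ≤ (c₀/2) √(log R + 1) + K²/(2c₀)` (`K = 16 + 8B`),
`√(log R + 1) ≤ √log R + 1` and `√log R ≤ √log⌊R⌋ + √log 2`. [folklore] -/
theorem exists_final_bound {c₀ B A : ℝ} (hc : 0 < c₀) (hB : 0 < B) (hA : 0 ≤ A) :
    ∃ C : ℝ, ∀ k : ℕ, 1 ≤ k → ∀ R : ℝ, 1 ≤ R → (k : ℝ) ≤ R ^ B →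
      A * Real.exp (4 * ∑ p ∈ k.primeFactors, (p : ℝ) ^ (-(3 / 4 : ℝ))) *
          Real.exp (-c₀ * Real.sqrt (Real.log ⌊R⌋₊)) ≤
        C * Real.exp (-(c₀ / 2) * Real.sqrt (Real.log R)) := by
  set K := 4 * (4 + 2 * B) with hK
  set D := c₀ / 2 + K ^ 2 / (2 * c₀) + c₀ * Real.sqrt (Real.log 2) with hD
  refine ⟨A * Real.exp D, fun k hk R hR hkR => ?_⟩
  set L := Real.log R with hL
  set N := ⌊R⌋₊ with hN
  have hL0 : 0 ≤ L := Real.log_nonneg hR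
  have hN1 : 1 ≤ N := Nat.le_floor (by simpa using hR)
  have hN1R : (1 : ℝ) ≤ N := by exact_mod_cast hN1
  have hNR : (0 : ℝ) < N := by linarith
  have hRN : R ≤ 2 * N := by
    have := Nat.lt_floor_add_one R
    linarith
  have hlogRN : L ≤ Real.log N + Real.log 2 := by
    calc L = Real.log R := rfl
      _ ≤ Real.log (2 * N) := Real.log_le_log (by linarith) hRN
      _ = Real.log N + Real.log 2 := by rw [Real.log_mul (by norm_num) hNR.ne']; ring
  have hsq1 : Real.sqrt L ≤ Real.sqrt (Real.log N) + Real.sqrt (Real.log 2) :=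
    CoprimeMoebiusDecay.sqrt_le_sqrt_add_sqrt (Real.log_nonneg hN1R) (Real.log_nonneg (by norm_num))
      hlogRN
  have hP : 4 * ∑ p ∈ k.primeFactors, (p : ℝ) ^ (-(3 / 4 : ℝ)) ≤ K * (L + 1) ^ (1 / 4 : ℝ) := by
    have := CoprimeMoebiusDecay.primeSum_le_of_le_rpow hB hk hR hkR
    rw [hK, mul_assoc]
    exact mul_le_mul_of_nonneg_left this (by norm_num)
  have hy : K * (L + 1) ^ (1 / 4 : ℝ) ≤ c₀ / 2 * Real.sqrt (L + 1) + K ^ 2 / (2 * c₀) := by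
    set y := (L + 1) ^ (1 / 4 : ℝ) with hy
    have hy2 : y ^ 2 = Real.sqrt (L + 1) := by
      rw [hy, Real.sqrt_eq_rpow, ← Real.rpow_natCast, ← Real.rpow_mul (by linarith)]; norm_num
    rw [← hy2]
    have : c₀ / 2 * y ^ 2 + K ^ 2 / (2 * c₀) - K * y = (c₀ / 2) * (y - K / c₀) ^ 2 := by
      field_simp; ring
    nlinarith [this, mul_nonneg (half_pos hc).le (sq_nonneg (y - K / c₀))]
  have hsq2 : Real.sqrt (L + 1) ≤ Real.sqrt L + 1 := by
    have := CoprimeMoebiusDecay.sqrt_le_sqrt_add_sqrt hL0 zero_le_one (le_refl (L + 1))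
    rwa [Real.sqrt_one] at this
  have hexp : 4 * ∑ p ∈ k.primeFactors, (p : ℝ) ^ (-(3 / 4 : ℝ)) + -c₀ * Real.sqrt (Real.log N) ≤
      D + -(c₀ / 2) * Real.sqrt L := by
    have h1 := mul_le_mul_of_nonneg_left hsq2 (half_pos hc).le
    have h2 := mul_le_mul_of_nonneg_left hsq1 hc.le
    rw [hD]
    linarith
  calc A * Real.exp (4 * ∑ p ∈ k.primeFactors, (p : ℝ) ^ (-(3 / 4 : ℝ))) *
        Real.exp (-c₀ * Real.sqrt (Real.log N))
      = A * Real.exp (4 * ∑ p ∈ k.primeFactors, (p : ℝ) ^ (-(3 / 4 : ℝ)) +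
          -c₀ * Real.sqrt (Real.log N)) := by rw [Real.exp_add]; ring
    _ ≤ A * Real.exp (D + -(c₀ / 2) * Real.sqrt L) :=
        mul_le_mul_of_nonneg_left (Real.exp_le_exp.2 hexp) hA
    _ = A * Real.exp D * Real.exp (-(c₀ / 2) * Real.sqrt L) := by rw [Real.exp_add]; ring

end GoldstonYildirimLemma21

/-! ### The theorem (2.13), `j = 1` -/

open Finset GoldstonYildirimLemma21 CoprimeMoebiusDecay
  Literature.NumberTheory.LFunctions.PlateauMollifier in
open scoped ArithmeticFunction.Moebius in
/-- **Goldston–Yıldırım I, Lemma 2.1, (2.13) at `j = 1`, PROVED**: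
`∑_{d ≤ R, (d,k)=1} μ(d)/φ(d) ≪ exp(-c √log R)` uniformly for `1 ≤ k ≤ R^B`
(elementary route from the tree's `∑_{n ≤ x} μ(n)/n ≪ exp(-c√log x)`; see the module docstring).
[cite: GoldstonYildirim2001, Lemma 2.1 (2.13) with j = 1, pp. 13, 17–18] -/
theorem goldstonYildirim_lemma21_j1_holds : goldstonYildirim_lemma21_j1 := by
  obtain ⟨c₀, hc₀, C₁, hC₁, hM⟩ := exists_abs_moebiusInvSum_le_exp
  refine ⟨c₀ / 2, half_pos hc₀, fun B hB => ?_⟩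
  obtain ⟨C, hC⟩ := exists_final_bound
    (A := C₁ * Real.exp (c₀ ^ 2) * (2 : ℝ) ^ (1 / 4 : ℝ) *
      (Real.exp (c₀ ^ 2) * (2 : ℝ) ^ (1 / 4 : ℝ) *
        Real.exp (8 * ∑' n : ℕ, (n : ℝ) ^ (-(7 / 4 : ℝ))))) hc₀ hB (by positivity)
  refine ⟨C, fun k hk R hR hkR => ?_⟩
  have hsum : ∑ d ∈ (Finset.Icc 1 ⌊R⌋₊).filter (fun d => Nat.Coprime d k),
      ((μ d : ℤ) : ℝ) / (Nat.totient d : ℝ) =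
        ∑ n ∈ Ioc 0 ⌊R⌋₊, (if n.Coprime k then (μ n : ℝ) / (Nat.totient n : ℝ) else 0) := by
    rw [Finset.sum_filter,
      show Finset.Icc 1 ⌊R⌋₊ = Finset.Ioc 0 ⌊R⌋₊ from Finset.Icc_add_one_left_eq_Ioc 0 _]
  rw [hsum]
  exact (abs_sum_coprime_moebius_div_totient_le hc₀ (by linarith) hM (by omega) ⌊R⌋₊).trans
    (hC k hk R hR hkR)

end Literature.NumberTheory.Sieve
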